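import Mathlib
import Literature.Barriers.QuantumFields.WilsonDeterminantSign
import Literature.MathematicalPhysics.QuantumLattice.OverlapLocality
import Literature.MathematicalPhysics.QuantumLattice.WilsonDiracRangeOne
import Literature.MathematicalPhysics.QuantumLattice.MobilityGap
import Literature.MathematicalPhysics.QuantumFieldTheory.QCD

/-!
# The well budget of bad patches and the geometry of `Γ₅ D_W` (support for stub `stub_windowModesLocalised`)
(line `block-away-the-sign`, crux `Summit.QuantumFields.QCD.Theses.SpectralDefectExtinction.ExtinctionBuildsQCD`,
item stmt-QuantumFields-18064)

* `stub_windowModesLocalisedAux4` — **the budget of bad patches** (abstract).  Given the min–max WELL BUDGET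
  (the landed stub `stub_wellBudget`, taken here as a hypothesis so that this file is independent of it): for a
  Hermitian matrix `H` on a finite index set `ι` fibred over sites (`site : ι → σ`) and of range one for a
  pseudo-distance on the sites, a family of patches `J` with enlarged boxes `B⁺_J ⊆ σ` and a reflexive symmetric
  closeness relation such that boxes of non-close patches are at distance `≥ 3` and at most `M` patches are close
  to any given one, the number of BAD patches (those carrying a strict quasi-mode `‖Hφ‖² < E²‖φ‖²` supported over
  `B⁺_J`) is at most `M · #{eigenvalues of H in (−E, E)}`: a maximal pairwise non-close family of bad patches has
  quasi-modes with disjoint supports and disjoint-support (hence orthogonal) `H`-images, so the well budget counts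
  it, and every bad patch is close to a member of the family.
* `hW_geometry` — the Hermitian Wilson–Dirac matrix `H = Γ₅ D_W(U, m₀, 1)` of an `SU(3)` field on `(ℤ/L)⁴`:
  Hermitian, range one in the taxi distance of the sites, non-zero off-site entries only between `x` and `x ± e_μ`,
  off-site absolute row and column sums `≤ 96` (from `Literature/…/WilsonDiracRangeOne`), and `‖x − y‖₁ = 0 ⇒ x = y`.

References (prose): Courant–Fischer min–max; Agmon, *Lectures on exponential decay* (1982); HJL 1999 §3.1.
-/

noncomputable section

namespace Summit.QuantumFields.QCD.Cruxes.ExtinctionBuildsQCD.BlockAwayTheSign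

open scoped BigOperators Classical Matrix
open Matrix Finset
open Literature.MathematicalPhysics.QuantumLattice Literature.MathematicalPhysics.QuantumFieldTheory
  Literature.Probability.LatticeModels
open Literature.Barriers.QuantumFields.WilsonDeterminant

namespace WindowModes

/-! ## The budget of bad patches -/

/-- **Helper W3-Aux4 (`stub_windowModesLocalisedAux4`) — the budget of bad patches from the well budget.** -/
theorem stub_windowModesLocalisedAux4 : (∀ {ι : Type} [Fintype ι] [DecidableEq ι] {H : Matrix ι ι ℂ}, H.IsHermitian → ∀ (E : ℝ), 0 < E → ∀ {k : ℕ} (φ : Fin k → ι → ℂ), (∀ a b, a ≠ b → ∀ i, φ a i = 0 ∨ φ b i = 0) → (∀ a b, a ≠ b → star (H *ᵥ φ a) ⬝ᵥ (H *ᵥ φ b) = 0) → (∀ a, ∑ i, ‖(H *ᵥ φ a) i‖ ^ 2 < E ^ 2 * ∑ i, ‖φ a i‖ ^ 2) → k ≤ H.charpoly.roots.countP (fun z => |z.re| < E)) → ∀ {ι σ 𝒥 : Type} [Fintype ι] [DecidableEq ι] [Fintype 𝒥] (site : ι → σ) (dist : σ → σ → ℕ), (∀ x, dist x x = 0) → (∀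 x y, dist x y = dist y x) → (∀ x y z, dist x z ≤ dist x y + dist y z) → ∀ {H : Matrix ι ι ℂ}, H.IsHermitian → (∀ p q, H p q ≠ 0 → dist (site p) (site q) ≤ 1) → ∀ (Bplus : 𝒥 → Finset σ) (Close : 𝒥 → 𝒥 → Prop), (∀ J, Close J J) → (∀ J J', Close J J' → Close J' J) → (∀ J J', ¬ Close J J' → ∀ x ∈ Bplus J, ∀ y ∈ Bplus J', 3 ≤ dist x y) → ∀ (M : ℕ), (∀ J, (Finset.univ.filter (Close J)).card ≤ M) → ∀ (E : ℝ), 0 < E → (Finset.univ.filter fun J => ∃ φ : ι → ℂ, (∀ p, site p ∉ Bplus J → φ p = 0) ∧ ∑ p, ‖(H *ᵥ φ) p‖ ^ 2 < E ^ 2 * ∑ p, ‖φ p‖ ^ 2).card ≤ M * H.charpoly.roots.countP (fun z => |z.re| < E) := by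
  intro hW1 ι σ 𝒥 _ _ _ site dist hd0 hds hdt H hH hrange Bplus Close hrefl hsymm hsep M hM E hE
  set Bad : Finset 𝒥 := univ.filter fun J => ∃ φ : ι → ℂ, (∀ p, site p ∉ Bplus J → φ p = 0) ∧
    ∑ p, ‖(H *ᵥ φ) p‖ ^ 2 < E ^ 2 * ∑ p, ‖φ p‖ ^ 2 with hBad
  have hBadspec : ∀ J ∈ Bad, ∃ φ : ι → ℂ, (∀ p, site p ∉ Bplus J → φ p = 0) ∧
      ∑ p, ‖(H *ᵥ φ) p‖ ^ 2 < E ^ 2 * ∑ p, ‖φ p‖ ^ 2 := fun J hJ => (mem_filter.mp hJ).2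
  choose! φ hφsupp hφq using hBadspec
  -- pairwise non-close subfamilies of `Bad`, and one of maximal cardinality
  set Fam : Finset (Finset 𝒥) :=
    Bad.powerset.filter fun F => ∀ a ∈ F, ∀ b ∈ F, a ≠ b → ¬ Close a b with hFam
  have hne : Fam.Nonempty := ⟨∅, by simp [hFam]⟩
  obtain ⟨F, hF, hmax⟩ := Finset.exists_max_image Fam Finset.card hne
  have hFBad : F ⊆ Bad := mem_powerset.mp (mem_filter.mp hF).1
  have hFsep : ∀ a ∈ F, ∀ b ∈ F, a ≠ b → ¬ Close a b := (mem_filter.mp hF).2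
  -- maximality: every bad patch is close to a member of `F`
  have hcover : ∀ J ∈ Bad, ∃ a ∈ F, Close a J := by
    intro J hJ
    by_contra hno
    push Not at hno
    have hJF : J ∉ F := fun h => hno J h (hrefl J)
    have hins : insert J F ∈ Fam := by
      rw [hFam, mem_filter, mem_powerset]
      refine ⟨insert_subset hJ hFBad, fun a ha b hb hab => ?_⟩
      rcases mem_insert.mp ha with rfl | ha'
      · rcases mem_insert.mp hb with rfl | hb'
        · exact absurd rfl hab
        · exact fun h => hno b hb' (hsymm _ _ h)
      · rcases mem_insert.mp hb with rfl | hb'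
        · exact hno a ha'
        · exact hFsep a ha' b hb' hab
    have := hmax _ hins
    rw [card_insert_of_notMem hJF] at this
    omega
  -- the well budget counts `F`
  have hk : F.card ≤ H.charpoly.roots.countP (fun z => |z.re| < E) := by
    set e := F.equivFin with he
    have hmemF : ∀ a : Fin F.card, ((e.symm a : F) : 𝒥) ∈ F := fun a => (e.symm a).2
    have hmemB : ∀ a : Fin F.card, ((e.symm a : F) : 𝒥) ∈ Bad := fun a => hFBad (hmemF a)
    have hneq : ∀ a b : Fin F.card, a ≠ b → ((e.symm a : F) : 𝒥) ≠ ((e.symm b : F) : 𝒥) :=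
      fun a b hab h => hab (e.symm.injective (Subtype.ext h))
    -- a non-zero entry of `φ_a` sits over `B⁺_a`
    have hsite : ∀ a : Fin F.card, ∀ p, φ ((e.symm a : F) : 𝒥) p ≠ 0 →
        site p ∈ Bplus ((e.symm a : F) : 𝒥) := by
      intro a p hp
      by_contra hh
      exact hp (hφsupp _ (hmemB a) p hh)
    -- a non-zero entry of `H φ_a` sits within distance `1` of `B⁺_a`
    have hHsite : ∀ a : Fin F.card, ∀ p, (H *ᵥ φ ((e.symm a : F) : 𝒥)) p ≠ 0 →
        ∃ q, dist (site p) (site q) ≤ 1 ∧ site q ∈ Bplus ((e.symm a : F) : 𝒥) := by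
      intro a p hp
      obtain ⟨q, -, hq⟩ := Finset.exists_ne_zero_of_sum_ne_zero hp
      exact ⟨q, hrange p q (left_ne_zero_of_mul hq), hsite a q (right_ne_zero_of_mul hq)⟩
    refine hW1 hH E hE (k := F.card) (fun a => φ ((e.symm a : F) : 𝒥)) ?_ ?_ ?_
    · -- disjoint supports
      intro a b hab p
      by_contra h
      push Not at h
      have h3 := hsep _ _ (hFsep _ (hmemF a) _ (hmemF b) (hneq a b hab)) _ (hsite a p h.1) _
        (hsite b p h.2)
      rw [hd0] at h3
      omega
    · -- orthogonal `H`-images (disjoint supports again, by range one)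
      intro a b hab
      have hpt : ∀ p, (H *ᵥ φ ((e.symm a : F) : 𝒥)) p = 0 ∨ (H *ᵥ φ ((e.symm b : F) : 𝒥)) p = 0 := by
        intro p
        by_contra h
        push Not at h
        obtain ⟨q, hq1, hq2⟩ := hHsite a p h.1
        obtain ⟨q', hq1', hq2'⟩ := hHsite b p h.2
        have h3 := hsep _ _ (hFsep _ (hmemF a) _ (hmemF b) (hneq a b hab)) _ hq2 _ hq2'
        have h4 := hdt (site q) (site p) (site q')
        rw [hds (site q) (site p)] at h4
        omega
      rw [dotProduct]
      exact Finset.sum_eq_zero fun p _ => by rcases hpt p with h | h <;> simp [h]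
    · exact fun a => hφq _ (hmemB a)
  -- counting
  calc Bad.card ≤ (F.biUnion fun a => univ.filter (Close a)).card := by
        refine card_le_card fun J hJ => ?_
        obtain ⟨a, ha, hc⟩ := hcover J hJ
        exact mem_biUnion.mpr ⟨a, ha, mem_filter.mpr ⟨mem_univ _, hc⟩⟩
    _ ≤ ∑ a ∈ F, (univ.filter (Close a)).card := card_biUnion_le
    _ ≤ ∑ _a ∈ F, M := sum_le_sum fun a _ => hM a
    _ = M * F.card := by rw [sum_const, smul_eq_mul, mul_comm]
    _ ≤ M * H.charpoly.roots.countP (fun z => |z.re| < E) := Nat.mul_le_mul_left M hk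

/-! ## The geometry of `Γ₅ D_W` -/

/-- **The geometry of the Hermitian Wilson–Dirac matrix** `H = Γ₅ D_W(U, m₀, 1)`, `SU(3)`, `r = 1`, any torus
`(ℤ/L)⁴`: `H` is Hermitian; a non-zero entry joins sites at taxi distance `≤ 1`, and, off the site-diagonal,
only sites `x`, `x ± e_μ`; the off-site absolute row and column sums are `≤ 96`; and the taxi distance
separates sites. -/
theorem hW_geometry {L : ℕ} [NeZero L] (U : GaugeConfig 4 L SU3) (m₀ : ℝ) :
    (hermitianWilsonDirac (fundamentalRep (Fin 3)) U m₀ 1).IsHermitian ∧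
    (∀ p q : Idx L 3, hermitianWilsonDirac (fundamentalRep (Fin 3)) U m₀ 1 p q ≠ 0 →
      torusTaxiDist p.1 q.1 ≤ 1) ∧
    (∀ p q : Idx L 3, hermitianWilsonDirac (fundamentalRep (Fin 3)) U m₀ 1 p q ≠ 0 → p.1 ≠ q.1 →
      ∃ μ : Fin 4, q.1 = p.1 + Pi.single μ 1 ∨ p.1 = q.1 + Pi.single μ 1) ∧
    (∀ p : Idx L 3, ∑ q ∈ univ.filter (fun q : Idx L 3 => torusTaxiDist p.1 q.1 ≠ 0),
      ‖hermitianWilsonDirac (fundamentalRep (Fin 3)) U m₀ 1 p q‖ ≤ 96) ∧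
    (∀ q : Idx L 3, ∑ p ∈ univ.filter (fun p : Idx L 3 => torusTaxiDist p.1 q.1 ≠ 0),
      ‖hermitianWilsonDirac (fundamentalRep (Fin 3)) U m₀ 1 p q‖ ≤ 96) ∧
    (∀ x y : TorusSite 4 L, torusTaxiDist x y = 0 → x = y) := by
  set H := hermitianWilsonDirac (fundamentalRep (Fin 3)) U m₀ 1 with hHdef
  have hρ : ∀ g : SU3, fundamentalRep (Fin 3) g ∈ Matrix.unitaryGroup (Fin 3) ℂ :=
    fun g => fundamentalRep_mem_unitaryGroup g
  -- entries of `H` have the moduli of the entries of `D_W`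
  have hnorm : ∀ p q : Idx L 3, ‖H p q‖ = ‖wilsonDirac (fundamentalRep (Fin 3)) U m₀ 1 p q‖ := by
    intro p q
    rw [hHdef, hermitianWilsonDirac, spinorLift_gammaFive_eq_diagonal, diagonal_mul, norm_mul]
    have h1 : ‖(![1, 1, -1, -1] : Fin 4 → ℂ) p.2.2‖ = 1 := by
      rcases p with ⟨x, a, α⟩
      fin_cases α <;> simp
    rw [h1, one_mul]
  have hne : ∀ p q : Idx L 3, H p q ≠ 0 → wilsonDirac (fundamentalRep (Fin 3)) U m₀ 1 p q ≠ 0 := by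
    intro p q h h0
    exact h (norm_eq_zero.mp (by rw [hnorm, h0, norm_zero]))
  refine ⟨isHermitian_hermitianWilsonDirac _ hρ U m₀ 1, fun p q h =>
    torusTaxiDist_le_one_of_wilsonDirac_ne_zero _ hρ U m₀ p q (hne p q h), fun p q h hpq => ?_,
    fun p => ?_, fun q => ?_, fun x y hxy => ?_⟩
  · -- adjacency: off the site-diagonal, `D_W p q ≠ 0` forces `q.1 = p.1 + e_μ` or `p.1 = q.1 + e_μ`
    by_contra hno
    push Not at hno
    refine hne p q h (wilsonDirac_apply_eq_zero_of_not_adj _ hρ U m₀ (fun h' => hpq (by rw [h']))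
      (fun μ => (hno μ).1) (fun μ => (hno μ).2))
  · calc _ = ∑ q ∈ univ.filter (fun q : Idx L 3 => torusTaxiDist p.1 q.1 ≠ 0),
          ‖wilsonDirac (fundamentalRep (Fin 3)) U m₀ 1 p q‖ :=
          Finset.sum_congr rfl fun q _ => hnorm p q
      _ ≤ 32 * (3 : ℕ) := wilsonDirac_rowSum_torusTaxiDist_le (fundamentalRep (Fin 3)) hρ U m₀ p
      _ = 96 := by norm_num
  · calc _ = ∑ p ∈ univ.filter (fun p : Idx L 3 => torusTaxiDist p.1 q.1 ≠ 0),
          ‖wilsonDirac (fundamentalRep (Fin 3)) U m₀ 1 p q‖ :=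
          Finset.sum_congr rfl fun p _ => hnorm p q
      _ ≤ 32 * (3 : ℕ) := wilsonDirac_colSum_torusTaxiDist_le (fundamentalRep (Fin 3)) hρ U m₀ q
      _ = 96 := by norm_num
  · -- `‖x − y‖₁ = 0 ⇒ x = y`
    funext i
    have hi : min (x i - y i).val (L - (x i - y i).val) = 0 := by
      have := (Finset.sum_eq_zero_iff.mp hxy) i (mem_univ i)
      exact this
    have hval : (x i - y i).val = 0 := by
      have := ZMod.val_lt (x i - y i)
      omega
    exact sub_eq_zero.mp ((ZMod.val_eq_zero _).mp hval)

end WindowModes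

end Summit.QuantumFields.QCD.Cruxes.ExtinctionBuildsQCD.BlockAwayTheSign

end
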